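import Summits.ResolutionOfSingularities.ResolutionOfSingularities.Theorems.PurelyInseparableDim4ResConeCInfTranslatedStepPrime
import HarnessLib
import HarnessLib.Audit.Tags

/-!
# Purely inseparable four-folds — ♯-PINNING of the flagless branch, every prime: in regime R a non-zero ♯-flag `g = coeff x_j³x_i³x_u^{d−2}`
# pins the u-translation of every in-regime slot step to `0` once the «cross» is dead, and the cross stays dead under pure slot steps
# (cell `res-dim4-pi`, K2(p) lane, power-cone light-pair line, flagless branch, FILE ♯5 = the p-3-lineage inputs of a ♯-window, like FILE 4)

[OURS · counted 0 · cell `res-dim4-pi` · K2(p) lane (holder res-dim4-p-12 g5); seat res-dim4-p-3 g6 (MEMO `res-dim4-p-3/MEMO-g6-FLAGLESS-SHARP.md` §3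
(VT-u♯), (ROW♯)).]  Nothing here proves K2(p) for any `p`, any TAIL(p, p−1, 3), `NoIsolatedTrap p p`, the Cossart–Jannsen–Saito theorem or resolution
of singularities in dimension ≥ 4 / characteristic `p` — NOT proved.  AI kernel work, weaker than expert review.  Exponent algebra of OUR frame.

F-exponents `(e_j, e_i, e_u, e_f)`; `d + 1 = p`, `4 ≤ d`; REGIME R: every `f`-free monomial has `e_j ≥ 3` and `e_i ≥ 3`.  The CROSS (MEMO X♯, in
F-exponents): the `κ`-arm `{(a, 3, d−3, 0) : a ≥ 4}` and the `o`-arm `{(3, b, d−3, 0) : b ≥ 4}`; the ♯-flag is `(3, 3, d−2, 0)` with coefficient `g`.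
* §1 `natCast_sub_two_ne_zero` (`(d − 2 : K) ≠ 0` in characteristic `p = d + 1 ≥ 5`), **`translation_eq_zero_of_sharp`** (VT-u♯): regime-R
  parent, `κ`-step translated by `β·e_u` whose child has NO monomial `(3, 3, d−3, 0)` (LAYER: residual degree `d + 1`), cross element
  `(4, 3, d−3, 0)` dead in the parent, `g ≠ 0` ⇒ `β = 0` (♯1 `coeff_sharp_step_translate_u`: `0 = (d − 2)·β·g + 0`).
* §2 **`cross_kappa_arm_step_zero`**, **`cross_o_arm_step_zero`** (ROW♯): under the PURE `κ`-step (`β = 0`) of a regime-R parent the child's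
  `κ`-arm element `(a, 3, d−3, 0)` is the parent's `(a+1, 3, d−3, 0)` and the child's `o`-arm element `(3, b, d−3, 0)` (`b ≥ 4`) is the parent's
  `(7 − b, b, d−3, 0)` — on the `o`-arm (`b = 4`) or absent (`b ≥ 5`, `e_j ≤ 2`): a dead cross stays dead (mirror for `o`-steps by `j ↔ i`).
[cite: Hauser2010, §§F–G] [cite: CossartJannsenSaito2020, Thm. 3.14]
bears_on: LADDER-RESOLUTION:D157-DOOR2 (res-dim4-pi · K2(p) · power cones · flagless branch ♯5).  Supports
stmt-ResolutionOfSingularities-16155 (helper).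
-/

set_option linter.dupNamespace false -- mandated namespace of this single-conjunct summit

noncomputable section

namespace Summit.ResolutionOfSingularities.ResolutionOfSingularities.Theorems.PIDim4

namespace ResCone

open MvPolynomial Finset
open Literature.AlgebraicGeometry.Resolution
open Literature.AlgebraicGeometry.Resolution.CentreBlowup
open Literature.AlgebraicGeometry.Resolution.Hauser2010
open Literature.AlgebraicGeometry.Resolution.HauserPerlega2019

variable {K : Type} [Field K] [DecidableEq K]

/-! ## 1. ♯-pinning -/

omit [DecidableEq K] in
/-- In characteristic `p = d + 1` with `4 ≤ d`, `(d − 2 : K) ≠ 0` (`0 < d − 2 < p`). [folklore] -/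
theorem natCast_sub_two_ne_zero (p : ℕ) [CharP K p] {d : ℕ} (hdp : d + 1 = p) (hd4 : 4 ≤ d) : ((d - 2 : ℕ) : K) ≠ 0 := by
  intro h
  rw [CharP.cast_eq_zero_iff K p] at h
  have := Nat.le_of_dvd (by omega) h
  omega

section Step

variable {j i u f : Fin 4} (hji : j ≠ i) (hju : j ≠ u) (hjf : j ≠ f) (hiu : i ≠ u) (hif : i ≠ f) (huf : u ≠ f)
include hji hju hjf hiu hif huf

/-- **♯-PINNING (VT-u♯)** (`d + 1 = p = char K`, `4 ≤ d`): parent in regime R (`f`-free monomials have `e_j ≥ 3`) with the cross element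
`x_j⁴x_i³x_u^{d−3}` DEAD and ♯-flag `g = coeff x_j³x_i³x_u^{d−2} ≠ 0`; if the child of the slot step in the chart of `j` translated by `β·e_u` has NO
monomial `x_j³x_i³x_u^{d−3}` (residual degree `d + 1`: LAYER), then `β = 0` — the translation is pinned by the ♯-flag exactly as res-dim4-typ-1's
(VT-u) pins it by the u-row flag. [OURS] [cite: Hauser2010, §§F–G] [cite: CossartJannsenSaito2020, Thm. 3.14] -/
theorem translation_eq_zero_of_sharp (p : ℕ) [CharP K p] {d : ℕ} (hdp : d + 1 = p) (hd4 : 4 ≤ d) (s : State K)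
    (hq : ((p : ℕ) : ℕ∞) ≤ ordAlong Finset.univ s.F) (hR : ∀ e ∈ s.F.support, e f = 0 → 3 ≤ e j) (β : K)
    (hcross : coeff (Finsupp.single j 4 + Finsupp.single i 3 + Finsupp.single u (d - 3) + Finsupp.single f 0) s.F = 0)
    (hg : coeff (Finsupp.single j 3 + Finsupp.single i 3 + Finsupp.single u (d - 2) + Finsupp.single f 0) s.F ≠ 0)
    (hlayer : coeff (Finsupp.single j 3 + Finsupp.single i 3 + Finsupp.single u (d - 3) + Finsupp.single f 0)
      (CentreBlowup.step p Finset.univ j (Function.update (0 : Fin 4 → K) u β) s).F = 0) :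
    β = 0 := by
  have h := coeff_sharp_step_translate_u hji hju hjf hiu hif huf p hdp hd4 s hq hR β
  rw [hlayer, hcross, add_zero] at h
  have hd2K := natCast_sub_two_ne_zero (K := K) p hdp hd4
  rcases mul_eq_zero.mp h.symm with h1 | h2
  · rcases mul_eq_zero.mp h1 with h3 | h4
    · exact absurd h3 hd2K
    · exact h4
  · exact absurd h2 hg

/-! ## 2. The cross stays dead under pure slot steps -/

/-- **κ-ARM UNDER THE PURE κ-STEP** (`d + 1 = p`, `4 ≤ d`): the child's coefficient at `(a, 3, d−3, 0)` is the parent's at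
`(a + 1, 3, d−3, 0)` (no translation: only the parent with the same `u`-exponent contributes). [OURS] [cite: Hauser2010, §§F–G] -/
theorem cross_kappa_arm_step_zero (p : ℕ) {d : ℕ} (hdp : d + 1 = p) (hd4 : 4 ≤ d) (s : State K)
    (hq : ((p : ℕ) : ℕ∞) ≤ ordAlong Finset.univ s.F) (a : ℕ) :
    coeff (Finsupp.single j a + Finsupp.single i 3 + Finsupp.single u (d - 3) + Finsupp.single f 0)
        (CentreBlowup.step p Finset.univ j (Function.update (0 : Fin 4 → K) u 0) s).F =
      coeff (Finsupp.single j (a + 1) + Finsupp.single i 3 + Finsupp.single u (d - 3) + Finsupp.single f 0) s.F := by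
  classical
  set γ : Fin 4 →₀ ℕ := Finsupp.single i 3 + Finsupp.single u (d - 3) + Finsupp.single f 0 with hγ
  have hγj : γ j = 0 := by
    rw [hγ, Finsupp.add_apply, Finsupp.add_apply, Finsupp.single_eq_of_ne hji, Finsupp.single_eq_of_ne hju,
      Finsupp.single_eq_of_ne hjf]; simp
  have hγi : γ i = 3 := by
    rw [hγ, Finsupp.add_apply, Finsupp.add_apply, Finsupp.single_eq_same, Finsupp.single_eq_of_ne hiu,
      Finsupp.single_eq_of_ne hif]; simp
  have hγu : γ u = d - 3 := by
    rw [hγ, Finsupp.add_apply, Finsupp.add_apply, Finsupp.single_eq_of_ne hiu.symm, Finsupp.single_eq_same,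
      Finsupp.single_eq_of_ne huf]; simp
  have hγf : γ f = 0 := by
    rw [hγ, Finsupp.add_apply, Finsupp.add_apply, Finsupp.single_eq_of_ne hif.symm, Finsupp.single_eq_of_ne huf.symm,
      Finsupp.single_eq_same]; simp
  have hE : (Finsupp.single j a + Finsupp.single i 3 + Finsupp.single u (d - 3) + Finsupp.single f 0 : Fin 4 →₀ ℕ) =
      γ + Finsupp.single j (p + a - p) := by
    rw [Nat.add_sub_cancel_left, hγ]; abel
  have hnp : ¬ IsPthPowerExponent p (γ + Finsupp.single j (p + a - p)) := by
    rw [← hE, isPthPowerExponent_iff]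
    intro h
    have h3 := h i
    rw [(quad_apply hji hju hjf hiu hif huf a 3 (d - 3) 0).2.1] at h3
    have := Nat.le_of_dvd (by norm_num) h3
    omega
  rw [hE, coeff_step_translate_u hji hju hjf hiu hif huf p s hq 0 (Nat.le_add_right p a) γ hγj hnp]
  set P : Fin 4 →₀ ℕ := Finsupp.single j (a + 1) + Finsupp.single i 3 + Finsupp.single u (d - 3) + Finsupp.single f 0 with hP
  obtain ⟨hPj, hPi, hPu, hPf⟩ := quad_apply hji hju hjf hiu hif huf (a + 1) 3 (d - 3) 0
  rw [Finset.sum_eq_single P]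
  · rw [hPu, hγu, Nat.choose_self, Nat.sub_self, pow_zero, Nat.cast_one, one_mul, one_mul]
  · intro δ hδ hne
    rw [Finset.mem_filter] at hδ
    obtain ⟨-, hm, hi, hf⟩ := hδ
    rcases Nat.lt_or_ge (δ u) (γ u) with hlt | hge
    · rw [Nat.choose_eq_zero_of_lt hlt, Nat.cast_zero, zero_mul, zero_mul]
    · rcases Nat.eq_or_lt_of_le hge with heq | hgt
      · exfalso
        apply hne
        have hq' := degree_eq_quad hji hju hjf hiu hif huf δ
        rw [hγi] at hi
        rw [hγf] at hf
        rw [hγu] at heq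
        have hδj : δ j = a + 1 := by omega
        rw [eq_sum_single_four hji hju hjf hiu hif huf δ, hδj, hi, ← heq, hf]
      · rw [zero_pow (Nat.sub_ne_zero_of_lt hgt), mul_zero, zero_mul]
  · intro hnot
    by_cases h0 : coeff P s.F = 0
    · rw [h0, mul_zero]
    · exfalso
      exact hnot (Finset.mem_filter.mpr ⟨mem_support_iff.mpr h0, by rw [hP, degree_quad]; omega, by rw [hPi, hγi], by rw [hPf, hγf]⟩)

/-- **o-ARM UNDER THE PURE κ-STEP** (`d + 1 = p`, `4 ≤ d`, regime R: `f`-free parent monomials have `e_j ≥ 3`): the child's coefficient at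
`(3, b, d−3, 0)` for `b ≥ 5` VANISHES (its only possible parent `(7 − b, b, d−3, 0)` has `e_j ≤ 2`), and for `b = 4` it is the parent's
coefficient at the `o`-arm element `(3, 4, d−3, 0)`. [OURS] [cite: Hauser2010, §§F–G] -/
theorem cross_o_arm_step_zero (p : ℕ) {d : ℕ} (hdp : d + 1 = p) (hd4 : 4 ≤ d) (s : State K)
    (hq : ((p : ℕ) : ℕ∞) ≤ ordAlong Finset.univ s.F) (hR : ∀ e ∈ s.F.support, e f = 0 → 3 ≤ e j) {b : ℕ} (hb : 4 ≤ b) :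
    coeff (Finsupp.single j 3 + Finsupp.single i b + Finsupp.single u (d - 3) + Finsupp.single f 0)
        (CentreBlowup.step p Finset.univ j (Function.update (0 : Fin 4 → K) u 0) s).F =
      if b = 4 then coeff (Finsupp.single j 3 + Finsupp.single i 4 + Finsupp.single u (d - 3) + Finsupp.single f 0) s.F else 0 := by
  classical
  set γ : Fin 4 →₀ ℕ := Finsupp.single i b + Finsupp.single u (d - 3) + Finsupp.single f 0 with hγ
  have hγj : γ j = 0 := by
    rw [hγ, Finsupp.add_apply, Finsupp.add_apply, Finsupp.single_eq_of_ne hji, Finsupp.single_eq_of_ne hju,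
      Finsupp.single_eq_of_ne hjf]; simp
  have hγi : γ i = b := by
    rw [hγ, Finsupp.add_apply, Finsupp.add_apply, Finsupp.single_eq_same, Finsupp.single_eq_of_ne hiu,
      Finsupp.single_eq_of_ne hif]; simp
  have hγu : γ u = d - 3 := by
    rw [hγ, Finsupp.add_apply, Finsupp.add_apply, Finsupp.single_eq_of_ne hiu.symm, Finsupp.single_eq_same,
      Finsupp.single_eq_of_ne huf]; simp
  have hγf : γ f = 0 := by
    rw [hγ, Finsupp.add_apply, Finsupp.add_apply, Finsupp.single_eq_of_ne hif.symm, Finsupp.single_eq_of_ne huf.symm,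
      Finsupp.single_eq_same]; simp
  have hE : (Finsupp.single j 3 + Finsupp.single i b + Finsupp.single u (d - 3) + Finsupp.single f 0 : Fin 4 →₀ ℕ) =
      γ + Finsupp.single j (p + 3 - p) := by
    rw [Nat.add_sub_cancel_left, hγ]; abel
  have hnp : ¬ IsPthPowerExponent p (γ + Finsupp.single j (p + 3 - p)) := by
    rw [← hE, isPthPowerExponent_iff]
    intro h
    have h3 := h j
    rw [(quad_apply hji hju hjf hiu hif huf 3 b (d - 3) 0).1] at h3
    have := Nat.le_of_dvd (by norm_num) h3
    omega
  rw [hE, coeff_step_translate_u hji hju hjf hiu hif huf p s hq 0 (Nat.le_add_right p 3) γ hγj hnp]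
  -- every term vanishes unless `δ_u = d − 3` and then `δ = (7 − b, b, d − 3, 0)`, present only if `7 − b ≥ 3`, i.e. `b = 4`
  set P : Fin 4 →₀ ℕ := Finsupp.single j 3 + Finsupp.single i 4 + Finsupp.single u (d - 3) + Finsupp.single f 0 with hP
  obtain ⟨hPj, hPi, hPu, hPf⟩ := quad_apply hji hju hjf hiu hif huf 3 4 (d - 3) 0
  have hterm : ∀ δ ∈ s.F.support, δ.degree = p + 3 → δ i = γ i → δ f = γ f → δ ≠ P →
      ((δ u).choose (γ u) : K) * (0 : K) ^ (δ u - γ u) * coeff δ s.F = 0 := by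
    intro δ hδ hm hi hf hne
    rcases Nat.lt_or_ge (δ u) (γ u) with hlt | hge
    · rw [Nat.choose_eq_zero_of_lt hlt, Nat.cast_zero, zero_mul, zero_mul]
    · rcases Nat.eq_or_lt_of_le hge with heq | hgt
      · exfalso
        have hq' := degree_eq_quad hji hju hjf hiu hif huf δ
        rw [hγi] at hi
        rw [hγf] at hf
        rw [hγu] at heq
        have h3 := hR δ hδ hf
        have hδj : δ j = 3 := by omega
        have hb4 : b = 4 := by omega
        apply hne
        rw [eq_sum_single_four hji hju hjf hiu hif huf δ, hδj, hi, ← heq, hf, hb4]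
      · rw [zero_pow (Nat.sub_ne_zero_of_lt hgt), mul_zero, zero_mul]
  split_ifs with hb4
  · rw [Finset.sum_eq_single P]
    · rw [hPu, hγu, Nat.choose_self, Nat.sub_self, pow_zero, Nat.cast_one, one_mul, one_mul]
    · intro δ hδ hne
      rw [Finset.mem_filter] at hδ
      exact hterm δ hδ.1 hδ.2.1 hδ.2.2.1 hδ.2.2.2 hne
    · intro hnot
      by_cases h0 : coeff P s.F = 0
      · rw [h0, mul_zero]
      · exfalso
        exact hnot (Finset.mem_filter.mpr
          ⟨mem_support_iff.mpr h0, by rw [hP, degree_quad]; omega, by rw [hPi, hγi, hb4], by rw [hPf, hγf]⟩)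
  · refine Finset.sum_eq_zero fun δ hδ => ?_
    rw [Finset.mem_filter] at hδ
    refine hterm δ hδ.1 hδ.2.1 hδ.2.2.1 hδ.2.2.2 fun h => hb4 ?_
    have := hδ.2.2.1
    rw [h, hPi, hγi] at this
    omega

end Step

end ResCone

end Summit.ResolutionOfSingularities.ResolutionOfSingularities.Theorems.PIDim4
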